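import Summits.Ventures.PercRepro.C041TriDomPendantHost

/-!
# ROW C-041 — THEOREM (THE SIBLING DOMINATION), II: THE CLASSES OF THE LEAF EXTENSION AND THE THEOREM
(p6, gen 50; P6-TWOEXIT-LEAN.md §53 ADDENDUM 24)

On the extension `pendHost Z₁ v` of `C041TriDomPendantHost` (a new leaf `z₀ = none` at `v` by the new free edge
`none`), the classes of the marks `(x, y, z₀)` are read off the old host: `(⊤,⊥)` is «the new edge red and the
sibling target» (`topBotS_pend`), `(s₁,s₂)` is «the new edge blue and the first sibling class» (`C12S_pend`),
`(s₃,s₁)` is «the new edge red and the second sibling class» (`C31S_pend`).  Each slice «new edge `= c` and an old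
class» counts like the old class (`card_pend_slice`, by the bijection `pendCol c`), and COROLLARY (TWO CLASSES)
(`pair12_31_le_topBotS`) on the extension at the up-set «the old part lies in `V`» (`upSet_pend`) is exactly the
sibling domination on the old host.  **THEOREM (THE SIBLING DOMINATION)** `sibDominationS_all : SibDominationS Z₁ x y
v st` for every host, status, marks `x, y` and terminal `v`.
-/

namespace PercRepro

namespace ZoneZ

namespace MultiExit

open ZoneData Finset

variable {V₁ E₁ U₁ U₂ : Type} (Z₁ : ZoneData V₁ E₁ U₁ U₂) (v : V₁) (st : E₁ → EStat)

/-! ## The classes of the extension, read off the old host -/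

variable (x y : V₁)

/-- `(⊤, ⊥)` of `(x, y, z₀)` on the extension: the new edge is red and the old part is in the sibling target. -/
theorem topBotS_pend (ω₂ : Option E₁ → Bool) :
    TopBotS (pendHost Z₁ v) (some x) (some y) none (pendSt st) ω₂ ↔
      ω₂ none = true ∧ SibTop Z₁ x y v st (oldCol ω₂) := by
  rw [topBotS_iff, RdS_pend_some, RdS_pend_none, RdS_pend_none, MgS_pend_some, MgS_pend_none, MgS_pend_none]
  unfold SibTop
  constructor
  · rintro ⟨⟨h1, ⟨h2, h3⟩, ⟨_, h4⟩⟩, ⟨h5, _, _⟩⟩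
    exact ⟨h2, h1, h3, h4, h5⟩
  · rintro ⟨h0, h1, h2, h3, h4⟩
    refine ⟨⟨h1, ⟨h0, h2⟩, ⟨h0, h3⟩⟩, ⟨h4, fun h => ?_, fun h => ?_⟩⟩
    · rw [h0] at h; exact Bool.noConfusion h.1
    · rw [h0] at h; exact Bool.noConfusion h.1

/-- `(s₁,s₂)` of `(x, y, z₀)` on the extension: the new edge is blue and the old part is in the first sibling class. -/
theorem C12S_pend (ω₂ : Option E₁ → Bool) :
    C12S (pendHost Z₁ v) (pendSt st) (some x) (some y) none ω₂ ↔
      ω₂ none = false ∧ SibC₁ Z₁ x y v st (oldCol ω₂) := by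
  unfold C12S SibC₁
  rw [RdS_pend_some, RdS_pend_none, RdS_pend_none, MgS_pend_some, MgS_pend_none, MgS_pend_none]
  constructor
  · rintro ⟨⟨h1, _, _⟩, ⟨h4, ⟨h5, h6⟩, h7⟩⟩
    refine ⟨h5, h1, h4, h6, fun h => h7 ⟨h5, h⟩⟩
  · rintro ⟨h0, h1, h2, h3, h4⟩
    refine ⟨⟨h1, fun h => ?_, fun h => ?_⟩, ⟨h2, ⟨h0, h3⟩, fun h => h4 h.2⟩⟩
    · rw [h0] at h; exact Bool.noConfusion h.1
    · rw [h0] at h; exact Bool.noConfusion h.1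

/-- `(s₃,s₁)` of `(x, y, z₀)` on the extension: the new edge is red and the old part is in the second sibling class. -/
theorem C31S_pend (ω₂ : Option E₁ → Bool) :
    C31S (pendHost Z₁ v) (pendSt st) (some x) (some y) none ω₂ ↔
      ω₂ none = true ∧ SibC₃ Z₁ x y v st (oldCol ω₂) := by
  unfold C31S SibC₃
  rw [RdS_pend_some, RdS_pend_none, RdS_pend_none, MgS_pend_some, MgS_pend_none, MgS_pend_none]
  constructor
  · rintro ⟨⟨h1, h2, ⟨h3, h4⟩⟩, ⟨h5, _, _⟩⟩
    exact ⟨h3, h4, h1, fun h => h2 ⟨h3, h⟩, h5⟩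
  · rintro ⟨h0, h1, h2, h3, h4⟩
    refine ⟨⟨h2, fun h => h3 h.2, ⟨h0, h1⟩⟩, ⟨h4, fun h => ?_, fun h => ?_⟩⟩
    · rw [h0] at h; exact Bool.noConfusion h.1
    · rw [h0] at h; exact Bool.noConfusion h.1

/-! ## Counting the slices -/

section Counting

variable [Fintype E₁] [DecidableEq E₁]

/-- The colouring of the extension with the new edge coloured `c` and the old part `ω`. -/
def pendCol (c : Bool) (ω : E₁ → Bool) : Option E₁ → Bool := fun e => match e with
  | some e => ω e
  | none => c

omit [Fintype E₁] [DecidableEq E₁] in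
/-- The old part of an extended colouring. -/
theorem oldCol_pendCol (c : Bool) (ω : E₁ → Bool) : oldCol (pendCol c ω) = ω := rfl

omit [Fintype E₁] [DecidableEq E₁] in
/-- An extended colouring is the extension of its old part by the colour of its new edge. -/
theorem pendCol_oldCol (ω₂ : Option E₁ → Bool) : pendCol (ω₂ none) (oldCol ω₂) = ω₂ := by
  funext e
  cases e <;> rfl

open Classical in
/-- A slice «the new edge is `c` and the old part satisfies `Q`» of the extension counts like `Q` on the old host. -/
theorem card_pend_slice (V : (E₁ → Bool) → Prop) (c : Bool) (Q : (E₁ → Bool) → Prop) :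
    (univ.filter fun ω₂ : Option E₁ → Bool => V (oldCol ω₂) ∧ ω₂ none = c ∧ Q (oldCol ω₂)).card =
      (univ.filter fun ω : E₁ → Bool => V ω ∧ Q ω).card := by
  symm
  refine Finset.card_bij (fun ω _ => pendCol c ω) (fun ω hω => ?_) (fun ω₁ _ ω₂ _ h => ?_) (fun ω₂ hω₂ => ?_)
  · rw [Finset.mem_filter] at hω ⊢
    exact ⟨Finset.mem_univ _, by rw [oldCol_pendCol]; exact hω.2.1, rfl, by rw [oldCol_pendCol]; exact hω.2.2⟩
  · have := congrArg oldCol h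
    rwa [oldCol_pendCol, oldCol_pendCol] at this
  · rw [Finset.mem_filter] at hω₂
    refine ⟨oldCol ω₂, ?_, ?_⟩
    · rw [Finset.mem_filter]
      exact ⟨Finset.mem_univ _, hω₂.2.1, hω₂.2.2.2⟩
    · rw [← hω₂.2.2.1]
      exact pendCol_oldCol ω₂

omit [Fintype E₁] [DecidableEq E₁] in
/-- The up-set «the old part lies in `V`» of the extension. -/
theorem upSet_pend {V : (E₁ → Bool) → Prop} (hV : UpSet V) :
    UpSet fun ω₂ : Option E₁ → Bool => V (oldCol ω₂) := by
  intro ω₂ ω₂' h hle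
  exact hV _ _ h fun e he => hle (some e) he

open Classical in
/-- **THEOREM (THE SIBLING DOMINATION)**: on every up-set of every status of every host, the two sibling classes of
`(x, y; v)` are outnumbered by the sibling target. -/
theorem sibDominationS_all : SibDominationS Z₁ x y v st := by
  intro V hV
  have h := pair12_31_le_topBotS (pendHost Z₁ v) (pendSt st) (some x) (some y) none (upSet_pend hV)
  -- the right side: the slice «`f₀` red, sibling target»
  have hR : (univ.filter fun ω₂ : Option E₁ → Bool => V (oldCol ω₂) ∧
      TopBotS (pendHost Z₁ v) (some x) (some y) none (pendSt st) ω₂).card =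
      (univ.filter fun ω : E₁ → Bool => V ω ∧ SibTop Z₁ x y v st ω).card := by
    rw [← card_pend_slice V true (SibTop Z₁ x y v st)]
    exact card_filter_congr' fun ω₂ _ => and_congr_right fun _ => topBotS_pend Z₁ v st x y ω₂
  -- the left side: the slices «`f₀` blue, first class» and «`f₀` red, second class», disjoint
  have hL : (univ.filter fun ω₂ : Option E₁ → Bool => V (oldCol ω₂) ∧
      (C12S (pendHost Z₁ v) (pendSt st) (some x) (some y) none ω₂ ∨
        C31S (pendHost Z₁ v) (pendSt st) (some x) (some y) none ω₂)).card =
      (univ.filter fun ω : E₁ → Bool => V ω ∧ (SibC₁ Z₁ x y v st ω ∨ SibC₃ Z₁ x y v st ω)).card := by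
    have e1 : (univ.filter fun ω₂ : Option E₁ → Bool => V (oldCol ω₂) ∧
        (C12S (pendHost Z₁ v) (pendSt st) (some x) (some y) none ω₂ ∨
          C31S (pendHost Z₁ v) (pendSt st) (some x) (some y) none ω₂)).card =
        (univ.filter fun ω₂ : Option E₁ → Bool =>
          (V (oldCol ω₂) ∧ ω₂ none = false ∧ SibC₁ Z₁ x y v st (oldCol ω₂)) ∨
            (V (oldCol ω₂) ∧ ω₂ none = true ∧ SibC₃ Z₁ x y v st (oldCol ω₂))).card := by
      refine card_filter_congr' fun ω₂ _ => ?_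
      rw [C12S_pend, C31S_pend]
      tauto
    have e2 : (univ.filter fun ω : E₁ → Bool => V ω ∧ (SibC₁ Z₁ x y v st ω ∨ SibC₃ Z₁ x y v st ω)).card =
        (univ.filter fun ω : E₁ → Bool => (V ω ∧ SibC₁ Z₁ x y v st ω) ∨ (V ω ∧ SibC₃ Z₁ x y v st ω)).card := by
      refine card_filter_congr' fun ω _ => ?_
      tauto
    rw [e1, e2, Finset.filter_or, Finset.filter_or, Finset.card_union_of_disjoint, Finset.card_union_of_disjoint,
      card_pend_slice, card_pend_slice]
    · rw [Finset.disjoint_filter]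
      rintro ω _ ⟨_, h1⟩ ⟨_, h3⟩
      exact h3.2.1 h1.1
    · rw [Finset.disjoint_filter]
      rintro ω₂ _ ⟨_, h1, _⟩ ⟨_, h3, _⟩
      rw [h1] at h3
      exact Bool.noConfusion h3
  rw [hL, hR] at h
  exact h

end Counting

end MultiExit

end ZoneZ

end PercRepro
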